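import Summits.QuantumFields.BalabanUV.Beta.GAN24.SymBornLambdaContactPairCellBounds

/-!
# `BalabanUV.Beta.GAN24.SymBornLambdaContactPairEntry` — binder row G-an2-4 ∕ (CONV-C), TRANSFER-III, the (III′) S-slot (b), born-Λ contact PAIR `hPc` (road-P2 M.104's 4th hypothesis), TABLE
# HALF («mksym lane»), PAIR PART 3 — THE PAIR SOCKET: **THE ENTRY BOUND OF THE DIFFERENCE OF THE Λ CONTACT TERMS OF TWO LINEAGES AT an1's SYMMETRISED CONSTRAINT HESSIAN
# `SΛ = SLam Lc c (symHessFFAt ρ Lc)`, GENERIC LEGS** — the decl-by-decl twin of MY g61 `BornLambdaContactPairEntry.abs_contactPair_entry_le` with `hessFFAt ↦ symHessFFAt`,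
# `linAvgAt ↦ symLinAvgAt`, `(2Lc^{d+1})⁻¹ ↦ (2·((d+1)!·Lc^{d+1}))⁻¹`, `Cnt ↦ Cnt_sym`, over MY PARTs 2∕7∕8 and PAIR PARTs 1∕2 BY NAME
# (G-an2-4 CRUX TEAM (2), leaf prover `b2b-balaban-gan24-formalise-leaf-01`, gen 90)

NOT IN PRINT; OUR BOOKKEEPING ([folklore]; 0 `def`, 0 cited fact, 0 `def … : Prop`, 0 sorry).  HONEST FRAMING (cell contract, verbatim): «discharging `BetaPertH` makes
Bałaban's UV stability UNCONDITIONAL — a real constructive-QFT result; it is NOT the continuum limit and NOT the Clay problem.»  HONEST DEPENDENCY (verbatim): «continuum YM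
on T⁴ ⇐ BetaPertH ∧ nine spine estimates (0/9 proved); BetaPertH ⇐ (D1) ∧ (D4) ∧ CAP+tail; G-an2-4 gates asym, D1 and NE2/3/4.»  Discharges NO letter of M.104 by itself;
NEVER «G-an2-4 closed» as (CONV-C); NOT D1, NOT `BetaPertH`, NOT continuum, NOT Clay.  2026-08-28; no existing file touched.
-/

noncomputable section

open Finset
open scoped BigOperators
open Literature.MathematicalPhysics.QuantumFieldTheory
open Literature.MathematicalPhysics.QuantumFieldTheory.LatticeForm (quo)
open Literature.MathematicalPhysics.QuantumFieldTheory.Balaban1983to89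
open Literature.MathematicalPhysics.QuantumFieldTheory.Balaban1983to89.Beta
open B4ContourShift (supNorm supNorm_nonneg)
open B12Sec2to5 (l1 l1_nonneg)
open ExpKernelCalculus (Zl Zl_nonneg)
open AffineAveraging (Form0 Form1 Site box toSite unitVec dz)
open AveragingContours (blk)
open AveragingHessianKernels (ell)
open Summit.QuantumFields.BalabanUV.Beta.SymmetrisedAxialPotential (symLinAvgAt)
open Summit.QuantumFields.BalabanUV.Beta.SymAveragingHessianCounts (symHessFFAt)
open InterLevelTransport (SLam)
open KernelWard (divV)
open Summit.QuantumFields.BalabanUV.Beta.GAN24.Push3 (push₃)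
open Summit.QuantumFields.BalabanUV.Beta.GAN24.Push3LegTelescope (abs_le_of_env' summable_of_env')
open Summit.QuantumFields.BalabanUV.Beta.GAN24.SymContactFaceJumpCommutator (commutator_eq_sum)
open Summit.QuantumFields.BalabanUV.Beta.GAN24.SymContactLambdaCellFactorised (contact_lambda_eq_factorised)
open Summit.QuantumFields.BalabanUV.Beta.GAN24.SymContactLambdaEntryBound (abs_sum_tsum_mixed_le abs_sum_tsum_dz_le)
open Summit.QuantumFields.BalabanUV.Beta.GAN24.SymBornLambdaContactPairCellBounds (abs_mixedPair_le abs_dzPair_le)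

namespace Summit.QuantumFields.BalabanUV.Beta.GAN24.SymBornLambdaContactPairEntry

variable {d : ℕ} {Lc : ℕ} {rr : Fin (d + 1) → ℕ} {n : ℕ} {κ : ℝ}
  {αg' αg αΔ KB' KB KΔ CT' CT Clam' Clam Tb' Tb TbΔ Cc' Cc δc' δc : ℝ}
  {T' B' T B : Fin (d + 1) → Site (d + 1) → Fin (d + 1) → Site (d + 1) → ℝ} {lam' lam : Fin (d + 1) → Site (d + 1) → Site (d + 1) → ℝ}
  {G' G GΔ : Fin (d + 1) → Site (d + 1) → ℕ → Site (d + 1) → ℝ} {c' c : Fin (d + 1) → Site (d + 1) → Fin (d + 1) → Site (d + 1) → ℝ}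

/-- [folklore] the first cell's `(μ,y)`-sum with the dressed partner `T β z′ = B β z′ + dz (λ β z′)` SPLITS into the mixed cell and the ΔΔ cell (leaf-02 g49's step, isolated; the two
summabilities are the ones their cell lemmas return). -/
theorem sum_tsum_split_of_sub_eq_dz {b : Fin (d + 1) → Site (d + 1) → ℝ} {ψ : Site (d + 1) → ℝ} {Tl Bl : Form1 (d + 1) ℝ} {laml : Site (d + 1) → ℝ}
    (hrr : rr ∈ box (d + 1) Lc) (hTB : ∀ b z, Tl b z = Bl b z + dz laml b z)
    (hs1 : ∀ μ, Summable fun y : Site (d + 1) => b μ y *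
      (symLinAvgAt (toSite rr) (fun a z => (ψ z + ψ (z + unitVec a)) * Bl a z) Lc μ y
        - (ψ ((Lc : ℤ) • y + toSite rr) + ψ ((Lc : ℤ) • y + toSite rr + (Lc : ℤ) • unitVec μ)) * symLinAvgAt (toSite rr) Bl Lc μ y))
    (hs2 : ∀ μ, Summable fun y : Site (d + 1) => b μ y *
      (symLinAvgAt (toSite rr) (fun a z => (ψ z + ψ (z + unitVec a)) * dz laml a z) Lc μ y
        - (ψ ((Lc : ℤ) • y + toSite rr) + ψ ((Lc : ℤ) • y + toSite rr + (Lc : ℤ) • unitVec μ)) * symLinAvgAt (toSite rr) (dz laml) Lc μ y)) :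
    (∑ μ, ∑' y : Site (d + 1), b μ y *
        (symLinAvgAt (toSite rr) (fun a z => (ψ z + ψ (z + unitVec a)) * Tl a z) Lc μ y
          - (ψ ((Lc : ℤ) • y + toSite rr) + ψ ((Lc : ℤ) • y + toSite rr + (Lc : ℤ) • unitVec μ)) * symLinAvgAt (toSite rr) Tl Lc μ y))
      = (∑ μ, ∑' y : Site (d + 1), b μ y *
          (symLinAvgAt (toSite rr) (fun a z => (ψ z + ψ (z + unitVec a)) * Bl a z) Lc μ y
            - (ψ ((Lc : ℤ) • y + toSite rr) + ψ ((Lc : ℤ) • y + toSite rr + (Lc : ℤ) • unitVec μ)) * symLinAvgAt (toSite rr) Bl Lc μ y))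
        + ∑ μ, ∑' y : Site (d + 1), b μ y *
          (symLinAvgAt (toSite rr) (fun a z => (ψ z + ψ (z + unitVec a)) * dz laml a z) Lc μ y
            - (ψ ((Lc : ℤ) • y + toSite rr) + ψ ((Lc : ℤ) • y + toSite rr + (Lc : ℤ) • unitVec μ)) * symLinAvgAt (toSite rr) (dz laml) Lc μ y) := by
  have hsplit : ∀ μ y,
      symLinAvgAt (toSite rr) (fun a z => (ψ z + ψ (z + unitVec a)) * Tl a z) Lc μ y
          - (ψ ((Lc : ℤ) • y + toSite rr) + ψ ((Lc : ℤ) • y + toSite rr + (Lc : ℤ) • unitVec μ)) * symLinAvgAt (toSite rr) Tl Lc μ y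
        = (symLinAvgAt (toSite rr) (fun a z => (ψ z + ψ (z + unitVec a)) * Bl a z) Lc μ y
            - (ψ ((Lc : ℤ) • y + toSite rr) + ψ ((Lc : ℤ) • y + toSite rr + (Lc : ℤ) • unitVec μ)) * symLinAvgAt (toSite rr) Bl Lc μ y)
          + (symLinAvgAt (toSite rr) (fun a z => (ψ z + ψ (z + unitVec a)) * dz laml a z) Lc μ y
            - (ψ ((Lc : ℤ) • y + toSite rr) + ψ ((Lc : ℤ) • y + toSite rr + (Lc : ℤ) • unitVec μ)) * symLinAvgAt (toSite rr) (dz laml) Lc μ y) := by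
    intro μ y
    rw [commutator_eq_sum hrr, commutator_eq_sum hrr, commutator_eq_sum hrr (B := dz laml), ← Finset.sum_add_distrib]
    refine Finset.sum_congr rfl fun x _ => ?_
    rw [← Finset.sum_add_distrib]
    refine Finset.sum_congr rfl fun a _ => ?_
    rw [hTB a x]; ring
  rw [← Finset.sum_add_distrib]
  refine Finset.sum_congr rfl fun μ _ => ?_
  rw [← (hs1 μ).tsum_add (hs2 μ)]
  refine tsum_congr fun y => ?_
  rw [hsplit μ y]; ring

/-- NOT IN PRINT; OUR BOOKKEEPING.  **THE Λ CONTACT ENTRY OF TWO TOP-ALIGNED LINEAGES, DIFFERENCED** (generic `d`; both towers carry leaf-02 g49's (C4) PART 3 data, three Δ-letters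
`α_Δ` (gauge staircase pieces), `K_Δ` (undressed legs), `T_Δ` (brackets) tie them; every term of the bound carries EXACTLY ONE Δ-letter). -/
theorem abs_contactPair_entry_le (hLc : 1 ≤ Lc) (hrr : rr ∈ box (d + 1) Lc) (hκ : 0 < κ)
    (hαg' : 0 ≤ αg') (hαg : 0 ≤ αg) (hαΔ : 0 ≤ αΔ) (hKB' : 0 ≤ KB') (hKB : 0 ≤ KB) (hKΔ : 0 ≤ KΔ) (hTb' : 0 ≤ Tb') (hTb : 0 ≤ Tb) (hTbΔ : 0 ≤ TbΔ)
    -- tower ′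
    (hc' : ∀ μ y κ u, |c' μ y κ u| ≤ Cc' * Real.exp (-δc' * l1 ((Lc : ℤ) • y - u))) (hδc' : 0 < δc') (hCc' : 0 ≤ Cc')
    (hdiv' : ∀ u, divV (SLam Lc c' (fun μ y => symHessFFAt (toSite rr) Lc μ y)) u = 0)
    (hT' : ∀ μ z κ u, |T' μ z κ u| ≤ CT') (hTs' : ∀ μ z κ, Summable fun u => T' μ z κ u)
    (hB' : ∀ μ z l u, |B' μ z l u| ≤ KB' * Real.exp (-(κ * supNorm (quo (Lc ^ (n + 1)) u - z))))
    (hTB' : T' - B' = fun μ z κ u => dz (lam' μ z) κ u) (hlam' : ∀ μ z u, |lam' μ z u| ≤ Clam')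
    (hψ' : ∀ μ₀ z₀ u, lam' μ₀ z₀ u = ∑ s ∈ Finset.range (n + 1), G' μ₀ z₀ s (blk (Lc ^ s) u))
    (hG' : ∀ μ₀ z₀ s, s ≤ n → ∀ u, |G' μ₀ z₀ s (blk (Lc ^ s) u)| ≤ αg' * (Lc : ℝ) ^ s * Real.exp (-(κ * supNorm (quo (Lc ^ (n + 1)) u - z₀))))
    (hbr' : ∀ (κ' : Fin (d + 1)) (u' : Site (d + 1)) μ y,
      |∑' u, ∑ κ, T' κ' u' κ u * c' μ y κ u| ≤ Tb' * Real.exp (-(κ * supNorm (quo (Lc ^ n) y - u'))))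
    -- tower (unprimed)
    (hc : ∀ μ y κ u, |c μ y κ u| ≤ Cc * Real.exp (-δc * l1 ((Lc : ℤ) • y - u))) (hδc : 0 < δc) (hCc : 0 ≤ Cc)
    (hdiv : ∀ u, divV (SLam Lc c (fun μ y => symHessFFAt (toSite rr) Lc μ y)) u = 0)
    (hT : ∀ μ z κ u, |T μ z κ u| ≤ CT) (hTs : ∀ μ z κ, Summable fun u => T μ z κ u)
    (hB : ∀ μ z l u, |B μ z l u| ≤ KB * Real.exp (-(κ * supNorm (quo (Lc ^ (n + 1)) u - z))))
    (hTB : T - B = fun μ z κ u => dz (lam μ z) κ u) (hlam : ∀ μ z u, |lam μ z u| ≤ Clam)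
    (hψ : ∀ μ₀ z₀ u, lam μ₀ z₀ u = ∑ s ∈ Finset.range (n + 1), G μ₀ z₀ s (blk (Lc ^ s) u))
    (hG : ∀ μ₀ z₀ s, s ≤ n → ∀ u, |G μ₀ z₀ s (blk (Lc ^ s) u)| ≤ αg * (Lc : ℝ) ^ s * Real.exp (-(κ * supNorm (quo (Lc ^ (n + 1)) u - z₀))))
    (hbr : ∀ (κ' : Fin (d + 1)) (u' : Site (d + 1)) μ y,
      |∑' u, ∑ κ, T κ' u' κ u * c μ y κ u| ≤ Tb * Real.exp (-(κ * supNorm (quo (Lc ^ n) y - u'))))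
    -- the three Δ-letters
    (hψΔ : ∀ μ₀ z₀ u, lam' μ₀ z₀ u - lam μ₀ z₀ u = ∑ s ∈ Finset.range (n + 1), GΔ μ₀ z₀ s (blk (Lc ^ s) u))
    (hGΔ : ∀ μ₀ z₀ s, s ≤ n → ∀ u, |GΔ μ₀ z₀ s (blk (Lc ^ s) u)| ≤ αΔ * (Lc : ℝ) ^ s * Real.exp (-(κ * supNorm (quo (Lc ^ (n + 1)) u - z₀))))
    (hBΔ : ∀ μ z l u, |B' μ z l u - B μ z l u| ≤ KΔ * Real.exp (-(κ * supNorm (quo (Lc ^ (n + 1)) u - z))))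
    (hbrΔ : ∀ (κ' : Fin (d + 1)) (u' : Site (d + 1)) μ y,
      |(∑' u, ∑ κ, T' κ' u' κ u * c' μ y κ u) - ∑' u, ∑ κ, T κ' u' κ u * c μ y κ u| ≤ TbΔ * Real.exp (-(κ * supNorm (quo (Lc ^ n) y - u'))))
    (κ' : Fin (d + 1)) (u' x' z' : Site (d + 1)) (α β : Fin (d + 1)) :
    |(push₃ T' T' T' (SLam Lc c' (fun μ y => symHessFFAt (toSite rr) Lc μ y)) κ' u' x' z' (Sum.inl α) (Sum.inl β)
        - push₃ B' B' B' (SLam Lc c' (fun μ y => symHessFFAt (toSite rr) Lc μ y)) κ' u' x' z' (Sum.inl α) (Sum.inl β))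
      - (push₃ T T T (SLam Lc c (fun μ y => symHessFFAt (toSite rr) Lc μ y)) κ' u' x' z' (Sum.inl α) (Sum.inl β)
        - push₃ B B B (SLam Lc c (fun μ y => symHessFFAt (toSite rr) Lc μ y)) κ' u' x' z' (Sum.inl α) (Sum.inl β))|
      ≤ (2 * ((((d + 1).factorial : ℕ) : ℝ) * (Lc : ℝ) ^ (d + 1)))⁻¹ *
          (((d : ℝ) + 1) * (Real.exp (2 * ((d : ℝ) + 1) * κ) ^ 2 *
              (((2 * Lc : ℕ) : ℝ) ^ (d + 1) * (((d + 1 : ℕ) : ℝ) * ((((d + 1).factorial : ℕ) : ℝ) * ((Lc : ℝ) ^ (d + 1) * (ell (d + 1) Lc : ℝ))))))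
            * ((TbΔ * KB' * (4 * αg' + 2 * αg' * Lc * n) + Tb * KB' * (4 * αΔ + 2 * αΔ * Lc * n) + Tb * KΔ * (4 * αg + 2 * αg * Lc * n))
                + (TbΔ * (8 * (αg' * αg') + 2 * (6 * (αg' * αg')) * Lc * n) + Tb * (8 * (αΔ * αg') + 2 * (6 * (αΔ * αg')) * Lc * n)
                    + Tb * (8 * (αg * αΔ) + 2 * (6 * (αg * αΔ)) * Lc * n))
                + (TbΔ * KB' * (4 * αg' + 2 * αg' * Lc * n) + Tb * KB' * (4 * αΔ + 2 * αΔ * Lc * n) + Tb * KΔ * (4 * αg + 2 * αg * Lc * n)))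
            * ((((Lc ^ n : ℕ) : ℝ)) ^ (d + 1) * Zl (d + 1) (κ / (4 * ((d : ℝ) + 1))))
            * Real.exp (-(κ / 12) * (supNorm (x' - u') + supNorm (z' - u')))) := by
  have hLn1 : 1 ≤ Lc ^ (n + 1) := Nat.one_le_pow _ _ hLc
  have hBb' : ∀ μ z l u, |B' μ z l u| ≤ KB' := abs_le_of_env' hκ.le hB'
  have hBs' : ∀ μ z l, Summable fun u => B' μ z l u := summable_of_env' hLn1 hκ hB'
  have hBb : ∀ μ z l u, |B μ z l u| ≤ KB := abs_le_of_env' hκ.le hB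
  have hBs : ∀ μ z l, Summable fun u => B μ z l u := summable_of_env' hLn1 hκ hB
  rw [contact_lambda_eq_factorised hLc hrr hc' hδc' hCc' hdiv' hT' hTs' hBb' hBs' hT' hTs' hBb' hBs' hT' hBb' hTB' hTB' hTB' hlam' κ' u' x' z' α β,
    contact_lambda_eq_factorised hLc hrr hc hδc hCc hdiv hT hTs hBb hBs hT hTs hBb hBs hT hBb hTB hTB hTB hlam κ' u' x' z' α β]
  -- the splits of the first cells' dressed partners
  have eT' : ∀ b z, T' β z' b z = B' β z' b z + dz (lam' β z') b z := fun b z => by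
    have h := congrFun (congrFun (congrFun (congrFun hTB' β) z') b) z
    simp only [Pi.sub_apply] at h
    linarith
  have eT : ∀ b z, T β z' b z = B β z' b z + dz (lam β z') b z := fun b z => by
    have h := congrFun (congrFun (congrFun (congrFun hTB β) z') b) z
    simp only [Pi.sub_apply] at h
    linarith
  obtain ⟨hs1', -⟩ := abs_sum_tsum_mixed_le (xg := x') (xl := z') hLc hrr hκ hαg' hKB' hTb' (hψ' α x') (hG' α x') (fun a x => hB' β z' a x) (hbr' κ' u')
  obtain ⟨hs2', -⟩ := abs_sum_tsum_dz_le (xg := x') (xl := z') hLc hrr hκ hαg' hTb' (hψ' α x') (hψ' β z') (hG' α x') (hG' β z') (hbr' κ' u')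
  obtain ⟨hs1, -⟩ := abs_sum_tsum_mixed_le (xg := x') (xl := z') hLc hrr hκ hαg hKB hTb (hψ α x') (hG α x') (fun a x => hB β z' a x) (hbr κ' u')
  obtain ⟨hs2, -⟩ := abs_sum_tsum_dz_le (xg := x') (xl := z') hLc hrr hκ hαg hTb (hψ α x') (hψ β z') (hG α x') (hG β z') (hbr κ' u')
  rw [sum_tsum_split_of_sub_eq_dz hrr eT' hs1' hs2', sum_tsum_split_of_sub_eq_dz hrr eT hs1 hs2]
  -- the three cell pairs
  have hP1 := abs_mixedPair_le (xg := x') (xl := z') (u' := u') (ψ' := lam' α x') (ψ := lam α x') (R' := B' β z') (R := B β z')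
    (b' := fun μ y => ∑' u, ∑ κ, T' κ' u' κ u * c' μ y κ u) (b := fun μ y => ∑' u, ∑ κ, T κ' u' κ u * c μ y κ u)
    hLc hrr hκ hαg' hαg hαΔ hKB' hKB hKΔ hTb' hTb hTbΔ (hψ' α x') (hψ α x') (hψΔ α x') (hG' α x') (hG α x') (hGΔ α x')
    (fun a x => hB' β z' a x) (fun a x => hB β z' a x) (fun a x => hBΔ β z' a x) (hbr' κ' u') (hbr κ' u') (hbrΔ κ' u')
  have hP2 := abs_dzPair_le (xg := x') (xl := z') (u' := u') (ψa' := lam' α x') (ψa := lam α x') (ψb' := lam' β z') (ψb := lam β z')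
    (b' := fun μ y => ∑' u, ∑ κ, T' κ' u' κ u * c' μ y κ u) (b := fun μ y => ∑' u, ∑ κ, T κ' u' κ u * c μ y κ u)
    hLc hrr hκ hαg' hαg hαΔ hαg' hαg hαΔ hTb' hTb hTbΔ (hψ' α x') (hψ α x') (hψΔ α x') (hψ' β z') (hψ β z') (hψΔ β z')
    (hG' α x') (hG α x') (hGΔ α x') (hG' β z') (hG β z') (hGΔ β z') (hbr' κ' u') (hbr κ' u') (hbrΔ κ' u')
  have hP3 := abs_mixedPair_le (xg := z') (xl := x') (u' := u') (ψ' := lam' β z') (ψ := lam β z') (R' := B' α x') (R := B α x')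
    (b' := fun μ y => ∑' u, ∑ κ, T' κ' u' κ u * c' μ y κ u) (b := fun μ y => ∑' u, ∑ κ, T κ' u' κ u * c μ y κ u)
    hLc hrr hκ hαg' hαg hαΔ hKB' hKB hKΔ hTb' hTb hTbΔ (hψ' β z') (hψ β z') (hψΔ β z') (hG' β z') (hG β z') (hGΔ β z')
    (fun a x => hB' α x' a x) (fun a x => hB α x' a x) (fun a x => hBΔ α x' a x) (hbr' κ' u') (hbr κ' u') (hbrΔ κ' u')
  rw [add_comm (supNorm (z' - u')) (supNorm (x' - u'))] at hP3
  -- combine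
  have hw : 0 ≤ (2 * ((((d + 1).factorial : ℕ) : ℝ) * (Lc : ℝ) ^ (d + 1)))⁻¹ := by positivity
  have e : ∀ A1' A2' A3' A1 A2 A3 : ℝ,
      (-(2 * ((((d + 1).factorial : ℕ) : ℝ) * (Lc : ℝ) ^ (d + 1)))⁻¹ * (A1' + A2') - -(2 * ((((d + 1).factorial : ℕ) : ℝ) * (Lc : ℝ) ^ (d + 1)))⁻¹ * A3')
          - (-(2 * ((((d + 1).factorial : ℕ) : ℝ) * (Lc : ℝ) ^ (d + 1)))⁻¹ * (A1 + A2) - -(2 * ((((d + 1).factorial : ℕ) : ℝ) * (Lc : ℝ) ^ (d + 1)))⁻¹ * A3)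
        = (2 * ((((d + 1).factorial : ℕ) : ℝ) * (Lc : ℝ) ^ (d + 1)))⁻¹ * ((A3' - A3) - ((A1' - A1) + (A2' - A2))) := fun _ _ _ _ _ _ => by ring
  rw [e, abs_mul, abs_of_nonneg hw]
  refine (mul_le_mul_of_nonneg_left ((abs_sub _ _).trans (add_le_add hP3 ((abs_add_le _ _).trans (add_le_add hP1 hP2)))) hw).trans
    (le_of_eq ?_)
  ring

end Summit.QuantumFields.BalabanUV.Beta.GAN24.SymBornLambdaContactPairEntry

end
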